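import Mathlib
import Summits.Ventures.HodgeRepro.Tier4.Line1.ResidualDirect
import Summits.Ventures.HodgeRepro.Tier4.Negative.TwistObstruction

/-!
# Tier4/Line1/ResidualDirectTwisted — LINE L1: the direct residual is EMPTY on the twisted members (the junk test of
`ResidualDirect` as a kernel theorem)

Blind re-derivation cell `pub-hodge-repro`, Tier 4 «prove the step» (README §9–§10), seat t4-L1-p4 (gen 3; the junk
test §3 of proofs/t4/L1/I5R-residual-direct-t4-L1-p4.md, now in the kernel).  Imports ONLY Mathlib, this seat's
`Tier4/Line1/ResidualDirect.lean` (p680517: `ResidualDirect`, `conclusion_of_residualDirect`,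
`P_T4_of_residualDirect`) and t4-L4-p2's `Tier4/Negative/TwistObstruction.lean` (p673864 / p676698:
`Negative.IsTwisted`, `Negative.conclusion_false_of_isTwisted`, `Negative.TwistedInstance`,
`Negative.not_P_T4_of_twistedInstance` — the kernel half of the negation probe).

WHAT IS PROVED.  The residual of record of LINE L1 («`Nonempty (ResidualDirect d)` for every datum `d`») is NOT
cheaply inhabitable, in the kernel:

* **`residualDirect_isEmpty_of_isTwisted`** — on a twisted datum `d` (L4-p2's `IsTwisted d`, the paper side (α)–(δ) of
  the negation probe, displayed) with the printed Borel–Harish-Chandra cocompactness `hK`, `ResidualDirect d` is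
  EMPTY: an inhabitant would give `d.conclusion` (`conclusion_of_residualDirect`), against
  `conclusion_false_of_isTwisted`;
* **`not_forall_residualDirect_of_twistedInstance`** — a `TwistedInstance` (some datum of `P_T4` twisted and cocompact)
  refutes «`ResidualDirect d` is inhabited for every `d`» (through `P_T4_of_residualDirect` and
  `not_P_T4_of_twistedInstance`).

So every construction of the residual must USE the corner characters' N2 (RTFData `chi_centre`, itself forced by the
defined block, CentralVanishingAdelic) in a way that FAILS on twisted data — which is exactly where the scope clause of
`line1_realise` says the mechanism of L1 produces nothing.  Nothing here says anything about the status of the Hodge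
conjecture for CM abelian varieties, which is NOT proved (HC_CM is NOT proved by anyone in this repository).
-/

set_option autoImplicit false

noncomputable section

namespace Summit.Ventures.HodgeRepro.Tier4.Line1

open NumberField

variable {F E : Type} [Field F] [NumberField F] [IsGalois ℚ F] [IsCMField F]
  [Field E] [NumberField E] [IsGalois ℚ E] [IsCMField E]

/-- **The direct residual is EMPTY on a twisted datum** (with the printed Borel–Harish-Chandra cocompactness `hK`):
an inhabitant of `ResidualDirect d` would give `d.conclusion`, which `conclusion_false_of_isTwisted` refutes. -/
theorem residualDirect_isEmpty_of_isTwisted (d : TargetData F E)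
    (hK : Lit.BorelHarishChandra1962_Thm11_8_cocompact_hdef E d.H d.τ₀ d.C) (hT : Negative.IsTwisted d) :
    IsEmpty (ResidualDirect d) :=
  ⟨fun I => Negative.conclusion_false_of_isTwisted d hK hT (conclusion_of_residualDirect I)⟩

/-- **A twisted instance refutes the universal inhabitation of the direct residual**: the hypothesis of
`P_T4_of_residualDirect` is false whenever `TwistedInstance` holds (`not_P_T4_of_twistedInstance`). -/
theorem not_forall_residualDirect_of_twistedInstance (h : Negative.TwistedInstance) :
    ¬ ∀ (F E : Type) [Field F] [NumberField F] [IsGalois ℚ F] [IsCMField F] [Field E] [NumberField E]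
      [IsGalois ℚ E] [IsCMField E] (d : TargetData F E), Nonempty (ResidualDirect d) :=
  fun hall => Negative.not_P_T4_of_twistedInstance h (P_T4_of_residualDirect hall)

end Summit.Ventures.HodgeRepro.Tier4.Line1

end
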